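import Summits.Ventures.PercRepro.GenQTraceCounts
import Summits.Ventures.PercRepro.GenQPlaneStays
import Summits.Ventures.PercRepro.GenQSolidTriples

/-!
# PercRepro — the row (R2): plane-type triples above a basis (night-4, gen 4)

Above a basis `B₀` of `G`, a plane-type set `B₀ ∪ X` with `X ⊆ G ∖ B₀`, `|X| = 3` (cyclic rank `3`: a `6`-point plane plus
`q − 3` coloops) has all three traces inside one `3`-subset `T` of `B₀`, and then `X = K_T := (G ∖ B₀) ∩ cl T`, a set
of at most `3` points (planes `≤ 6`).  Counting `Σ_T |K_T| = (q − 2)·k₂(B₀) + k₃(B₀)` (a point `x` lies in `cl T` iff its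
trace `C_x ∖ x` lies in `T`), the plane-type triples above `B₀` number at most `Σ_T |K_T| / 3`; summed over the bases
(`sum_kc_eq`) and against `nb(S) ≥ 16` for the level-`(d−3)` plane-type sets:
**`48·#Pc (d−3) (q−3) ≤ 3(q−2)·#Pc (d−1) (q−2) + 4·#Pc (d−1) (q−3)`** (`card_Pc_sub_three_plane_le`; at `q = 6` the row
`16·Pc[d−3][3] ≤ 4·Pc[d−1][4] + (4/3)·Pc[d−1][3]` of sheet §55).

Imports `GenQTraceCounts`, `GenQPlaneStays` (`cyclic_part_of_plane_type`) and `GenQSolidTriples`.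
-/
namespace PercRepro.Night4

open Finset ThmH SixFour GenQ PerFlat Star

variable {α : Type*} [DecidableEq α] {M : Matroid α} [M.Finite]

/-- **`x ∈ cl T ↔ C_x ∖ x ⊆ T`** for `T ⊆ B₀` (`B₀` a basis of `G`, `x ∈ G ∖ B₀`). -/
theorem mem_closure_iff_fc_erase_subset {G B₀ T : Finset α} {q : ℕ} (hG : G ⊆ gr M)
    (hrG : M.eRk (G : Set α) = (q : ℕ∞)) (hB : B₀ ∈ basesOf M G q) (hT : T ⊆ B₀) {x : α} (hx : x ∈ G)
    (hxB : x ∉ B₀) : x ∈ M.closure (T : Set α) ↔ (fc M x B₀).erase x ⊆ T := by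
  have hI := indep_of_mem_basesOf hB
  have hxcl := mem_closure_of_mem_basesOf hG hrG hB hx
  have hC : M.IsCircuit ((fc M x B₀ : Finset α) : Set α) := isCircuit_fc hI hxcl hxB
  have hIT : M.Indep (T : Set α) := hI.subset (Finset.coe_subset.2 hT)
  have hxT : x ∉ T := fun h => hxB (hT h)
  constructor
  · intro h
    -- `fundCircuit x T` is a circuit inside `insert x T ⊆ insert x B₀`, hence equals `fundCircuit x B₀`
    have hC' : M.IsCircuit (M.fundCircuit x (T : Set α)) := hIT.fundCircuit_isCircuit h (by exact_mod_cast hxT)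
    have hsub : M.fundCircuit x (T : Set α) ⊆ insert x (B₀ : Set α) :=
      (M.fundCircuit_subset_insert x (T : Set α)).trans (Set.insert_subset_insert (Finset.coe_subset.2 hT))
    have heq : M.fundCircuit x (T : Set α) = M.fundCircuit x (B₀ : Set α) :=
      hC'.eq_fundCircuit_of_subset hI hsub
    intro y hy
    rw [Finset.mem_erase, mem_fc, ← heq] at hy
    have := M.fundCircuit_subset_insert x (T : Set α) hy.2
    rw [Set.mem_insert_iff] at this
    rcases this with h' | h'
    · exact absurd h' hy.1
    · exact Finset.mem_coe.1 h'
  · intro h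
    have hxcl' : x ∈ M.closure (((fc M x B₀).erase x : Finset α) : Set α) := by
      have := hC.mem_closure_sdiff_singleton_of_mem (Finset.mem_coe.2 (mem_fc_self x B₀))
      rwa [Finset.coe_erase]
    exact M.closure_subset_closure (Finset.coe_subset.2 h) hxcl'

/-- `K_T = (G ∖ B₀) ∩ cl T`: the points of `G` above the basis whose trace lies in `T`. -/
noncomputable def KT (M : Matroid α) [M.Finite] (G B₀ T : Finset α) : Finset α :=
  (G \ B₀).filter (fun x => x ∈ clF M T)

/-- Membership in `K_T`. -/
theorem mem_KT {G B₀ T : Finset α} {x : α} : x ∈ KT M G B₀ T ↔ x ∈ G \ B₀ ∧ x ∈ M.closure (T : Set α) := by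
  unfold KT
  rw [Finset.mem_filter, mem_clF]

/-- `|K_T| ≤ 3` for a `3`-subset `T` of a basis (planes `≤ 6` points). -/
theorem card_KT_le_three (hplane : ∀ P ∈ flatsQ M 3, P.card ≤ 6) {G B₀ T : Finset α} {q : ℕ} (hG : G ⊆ gr M)
    (hB : B₀ ∈ basesOf M G q) (hT : T ∈ B₀.powersetCard 3) : (KT M G B₀ T).card ≤ 3 := by
  have hI := indep_of_mem_basesOf hB
  obtain ⟨hBG, _, _⟩ := mem_basesOf.1 hB
  have hT' := Finset.mem_powersetCard.1 hT
  have hTg : T ⊆ gr M := hT'.1.trans (hBG.trans hG)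
  have hTE : (T : Set α) ⊆ M.E := by
    rw [← coe_gr M]
    exact Finset.coe_subset.2 hTg
  have hIT : M.Indep (T : Set α) := hI.subset (Finset.coe_subset.2 hT'.1)
  have hr : M.eRk (T : Set α) = ((3 : ℕ) : ℕ∞) := by
    rw [hIT.eRk_eq_encard, Set.encard_coe_eq_coe_finsetCard, hT'.2]
  have hP : clF M T ∈ flatsQ M 3 := by
    rw [mem_flatsQ]
    refine ⟨?_, ?_, ?_⟩
    · intro x hx
      rw [← Finset.mem_coe, coe_clF] at hx
      have := M.closure_subset_ground _ hx
      rw [← coe_gr M] at this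
      exact Finset.mem_coe.1 this
    · rw [coe_clF]
      exact M.isFlat_closure _
    · rw [coe_clF, M.eRk_closure_eq, hr]
  have h6 := hplane _ hP
  -- `T ∪ K_T ⊆ cl T`, disjointly
  have hsub : T ∪ KT M G B₀ T ⊆ clF M T := by
    intro x hx
    rw [Finset.mem_union] at hx
    rw [← Finset.mem_coe, coe_clF]
    rcases hx with h | h
    · exact M.mem_closure_of_mem' (Finset.mem_coe.2 h) (hTE (Finset.mem_coe.2 h))
    · exact (mem_KT.1 h).2
  have hdisj : Disjoint T (KT M G B₀ T) := by
    rw [Finset.disjoint_left]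
    intro x hxT hxK
    have := (Finset.mem_sdiff.1 (mem_KT.1 hxK).1).2
    exact this (hT'.1 hxT)
  have := Finset.card_le_card hsub
  rw [Finset.card_union_of_disjoint hdisj, hT'.2] at this
  omega

/-- The `3`-subsets of `B₀` containing the trace `A = C_x ∖ x`: at most `q − 2` when `|A| = 2` (`A ∪ {b}`), one when
`|A| = 3` (`A` itself), none when `|A| ≥ 4`. -/
theorem card_filter_trace_subset_le (hs : Simple M) {G B₀ : Finset α} {q : ℕ} (hG : G ⊆ gr M)
    (hrG : M.eRk (G : Set α) = (q : ℕ∞)) (hq : 3 ≤ q) (hB : B₀ ∈ basesOf M G q) {x : α} (hx : x ∈ G)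
    (hxB : x ∉ B₀) :
    ((B₀.powersetCard 3).filter (fun T => (fc M x B₀).erase x ⊆ T)).card ≤
      if (fc M x B₀).card = 3 then q - 2 else if (fc M x B₀).card = 4 then 1 else 0 := by
  obtain ⟨hBG, _, hc⟩ := mem_basesOf.1 hB
  have hA : (fc M x B₀).erase x ⊆ B₀ := fc_erase_subset x
  have hAc : ((fc M x B₀).erase x).card + 1 = (fc M x B₀).card := Finset.card_erase_add_one (mem_fc_self x B₀)
  have h3fc : 3 ≤ (fc M x B₀).card :=
    three_le_card_fc hs (hBG.trans hG) (hG hx) (indep_of_mem_basesOf hB) (mem_closure_of_mem_basesOf hG hrG hB hx) hxB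
      (Finset.card_pos.1 (by rw [hc]; omega))
  set A := (fc M x B₀).erase x with hAdef
  by_cases h3 : (fc M x B₀).card = 3
  · -- `|A| = 2`: `T = insert b A`, `b ∈ B₀ ∖ A`
    rw [if_pos h3]
    have hA2 : A.card = 2 := by omega
    calc ((B₀.powersetCard 3).filter (fun T => A ⊆ T)).card
        ≤ ((B₀ \ A).image (fun b => insert b A)).card := by
          apply Finset.card_le_card
          intro T hT
          rw [Finset.mem_filter, Finset.mem_powersetCard] at hT
          obtain ⟨⟨hTB, hTc⟩, hAT⟩ := hT
          obtain ⟨b, hbT, hbA⟩ := Finset.exists_mem_notMem_of_card_lt_card (show A.card < T.card by omega)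
          rw [Finset.mem_image]
          refine ⟨b, Finset.mem_sdiff.2 ⟨hTB hbT, hbA⟩, ?_⟩
          apply Finset.eq_of_subset_of_card_le (Finset.insert_subset hbT hAT)
          rw [Finset.card_insert_of_notMem hbA, hA2, hTc]
      _ ≤ (B₀ \ A).card := Finset.card_image_le
      _ = q - 2 := by rw [Finset.card_sdiff_of_subset hA, hc, hA2]
  · by_cases h4 : (fc M x B₀).card = 4
    · rw [if_neg h3, if_pos h4]
      have hA3 : A.card = 3 := by omega
      rw [Finset.card_le_one]
      intro T hT T' hT'
      rw [Finset.mem_filter, Finset.mem_powersetCard] at hT hT'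
      have e1 : T = A := (Finset.eq_of_subset_of_card_le hT.2 (by rw [hT.1.2, hA3])).symm
      have e2 : T' = A := (Finset.eq_of_subset_of_card_le hT'.2 (by rw [hT'.1.2, hA3])).symm
      rw [e1, e2]
    · rw [if_neg h3, if_neg h4, Nat.le_zero, Finset.card_eq_zero, Finset.filter_eq_empty_iff]
      intro T hT hAT
      rw [Finset.mem_powersetCard] at hT
      have := Finset.card_le_card hAT
      omega

/-- **`Σ_{T ∈ C(B₀, 3)} |K_T| ≤ (q − 2)·k₂ + k₃`**. -/
theorem sum_card_KT_le (hs : Simple M) {G B₀ : Finset α} {q : ℕ} (hG : G ⊆ gr M)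
    (hrG : M.eRk (G : Set α) = (q : ℕ∞)) (hq : 3 ≤ q) (hB : B₀ ∈ basesOf M G q) :
    ∑ T ∈ B₀.powersetCard 3, (KT M G B₀ T).card ≤ (q - 2) * kc M G B₀ 3 + kc M G B₀ 4 := by
  -- double count the pairs `(T, x)` with `x ∈ K_T`
  have h1 : ∑ T ∈ B₀.powersetCard 3, (KT M G B₀ T).card =
      ∑ x ∈ G \ B₀, ((B₀.powersetCard 3).filter (fun T => (fc M x B₀).erase x ⊆ T)).card := by
    unfold KT
    simp only [Finset.card_eq_sum_ones, Finset.sum_filter]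
    rw [Finset.sum_comm]
    apply Finset.sum_congr rfl
    intro x hx
    apply Finset.sum_congr rfl
    intro T hT
    have hxG := (Finset.mem_sdiff.1 hx).1
    have hxB := (Finset.mem_sdiff.1 hx).2
    simp only [mem_clF, mem_closure_iff_fc_erase_subset hG hrG hB (Finset.mem_powersetCard.1 hT).1 hxG hxB]
  rw [h1]
  calc ∑ x ∈ G \ B₀, ((B₀.powersetCard 3).filter (fun T => (fc M x B₀).erase x ⊆ T)).card
      ≤ ∑ x ∈ G \ B₀, (if (fc M x B₀).card = 3 then q - 2 else if (fc M x B₀).card = 4 then 1 else 0) :=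
        Finset.sum_le_sum (fun x hx => card_filter_trace_subset_le hs hG hrG hq hB (Finset.mem_sdiff.1 hx).1
          (Finset.mem_sdiff.1 hx).2)
    _ = (q - 2) * kc M G B₀ 3 + kc M G B₀ 4 := by
        unfold kc
        rw [Finset.card_filter, Finset.card_filter, Finset.mul_sum, ← Finset.sum_add_distrib]
        apply Finset.sum_congr rfl
        intro x _
        split_ifs <;> omega

/-! ## The level-`(d−3)` plane-type sets and their bases -/

/-- A coloop of `S` lies in every basis of `G` inside `S`. -/
theorem coloopsOf_subset_of_basis_subset {G S B₀ : Finset α} {q : ℕ} (hG : G ⊆ gr M) (hS : S ∈ Rq M G q)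
    (hB : B₀ ∈ basesOf M G q) (hBS : B₀ ⊆ S) : coloopsOf M S ⊆ B₀ := by
  intro k hk
  by_contra hkB
  have hk' := mem_coloopsOf.1 hk
  have hsub : B₀ ⊆ S.erase k := fun y hy => Finset.mem_erase.2 ⟨fun h => hkB (h ▸ hy), hBS hy⟩
  have hr := eRk_erase_add_one_of_notMem_closure ((mem_Rq.1 hS).1.trans hG) hk'.1 hk'.2
  rw [(mem_Rq.1 hS).2] at hr
  have hle : M.eRk (B₀ : Set α) ≤ M.eRk ((S.erase k : Finset α) : Set α) := M.eRk_mono (Finset.coe_subset.2 hsub)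
  rw [(mem_basesOf.1 hB).2.1] at hle
  have hfin : M.eRk ((S.erase k : Finset α) : Set α) ≠ ⊤ := by
    have := M.eRk_le_encard ((S.erase k : Finset α) : Set α)
    rw [Set.encard_coe_eq_coe_finsetCard] at this
    exact ne_top_of_le_ne_top (by simp) this
  have : (q : ℕ∞) + 1 ≤ (q : ℕ∞) := by
    calc (q : ℕ∞) + 1 ≤ M.eRk ((S.erase k : Finset α) : Set α) + 1 := by gcongr
      _ = (q : ℕ∞) := hr
  have h' : ((q + 1 : ℕ) : ℕ∞) ≤ ((q : ℕ) : ℕ∞) := by push_cast; exact this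
  have h'' : q + 1 ≤ q := by exact_mod_cast h'
  omega

/-- **`nb(S) ≥ 16`** for a level-`(d−3)` plane-type set (a `6`-point plane `Z` plus `q − 3` coloops): the sets
`T ∪ K`, `T` a rank-`3` triple of `Z`, are bases of `G` inside `S`. -/
theorem sixteen_le_nb (hs : Simple M) (hline : ∀ L ∈ flatsQ M 2, L.card ≤ 3) {G S : Finset α} {q d : ℕ}
    (hG : G ⊆ gr M) (hq : 3 ≤ q) (hcard : G.card = q + d)
    (hS : S ∈ Pc M G q (d - 3) (q - 3)) (hd : 3 ≤ d) : 16 ≤ nb M G S q := by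
  obtain ⟨hZr, hZc⟩ := cyclic_part_of_plane_type hG hq hcard hS
  have hS' := mem_Pc.1 hS
  have hSG := (mem_Rq.1 hS'.1).1
  have hZg : S \ coloopsOf M S ⊆ gr M := Finset.sdiff_subset.trans (hSG.trans hG)
  have h6 : (S \ coloopsOf M S).card = 6 := by rw [hZc]; omega
  have htr := (card_rank_three_triples_ge hs hline hZg).1 h6
  unfold nb
  refine le_trans htr (Finset.card_le_card_of_injOn (fun T => T ∪ coloopsOf M S) ?_ ?_)
  · intro T hT
    rw [Finset.mem_coe, Finset.mem_filter, Finset.mem_powersetCard] at hT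
    obtain ⟨⟨hTZ, hTc⟩, hTr⟩ := hT
    rw [Finset.mem_coe, Finset.mem_filter]
    have hdisj : Disjoint T (coloopsOf M S) := by
      rw [Finset.disjoint_left]
      intro y hyT hyK
      exact (Finset.mem_sdiff.1 (hTZ hyT)).2 hyK
    have hsub : T ∪ coloopsOf M S ⊆ S := Finset.union_subset (hTZ.trans Finset.sdiff_subset) (coloopsOf_subset S)
    have hr := eRk_union_coloopsOf_eq hG hS'.1 hTZ
    rw [hTr, hS'.2.2] at hr
    have hr' : M.eRk ((T ∪ coloopsOf M S : Finset α) : Set α) = (q : ℕ∞) := by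
      rw [hr]
      norm_cast
      omega
    refine ⟨mem_basesOf.2 ⟨hsub.trans hSG, hr', ?_⟩, hsub⟩
    rw [Finset.card_union_of_disjoint hdisj, hTc]
    unfold mTr at hS'
    omega
  · intro T hT T' hT' heq
    rw [Finset.mem_coe, Finset.mem_filter, Finset.mem_powersetCard] at hT hT'
    have hdisj : ∀ U, U ⊆ S \ coloopsOf M S → Disjoint U (coloopsOf M S) := fun U hU => by
      rw [Finset.disjoint_left]
      intro y hyU hyK
      exact (Finset.mem_sdiff.1 (hU hyU)).2 hyK
    have e1 := Finset.union_sdiff_cancel_right (hdisj T hT.1.1)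
    have e2 := Finset.union_sdiff_cancel_right (hdisj T' hT'.1.1)
    simp only at heq
    rw [← e1, ← e2, heq]

/-- **The pairs `(S, B₀)` inject into the pairs `(B₀, T)` with `|K_T| = 3`**: `Σ_{S ∈ Pc (d−3) (q−3)} nb S ≤ Σ_{B₀} #{T : |K_T| = 3}`. -/
theorem sum_nb_plane_le (hplane : ∀ P ∈ flatsQ M 3, P.card ≤ 6) {G : Finset α} {q d : ℕ} (hG : G ⊆ gr M)
    (hq : 3 ≤ q) (hcard : G.card = q + d) (hd : 3 ≤ d) :
    ∑ S ∈ Pc M G q (d - 3) (q - 3), nb M G S q ≤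
      ∑ B₀ ∈ basesOf M G q, ((B₀.powersetCard 3).filter (fun T => (KT M G B₀ T).card = 3)).card := by
  unfold nb
  rw [← Finset.card_sigma, ← Finset.card_sigma]
  apply Finset.card_le_card_of_injOn (fun p => ⟨p.2, p.2 \ coloopsOf M p.1⟩)
  · rintro ⟨S, B₀⟩ hp
    rw [Finset.mem_coe, Finset.mem_sigma, Finset.mem_filter] at hp
    simp only at hp ⊢
    obtain ⟨hS, hB₀, hBS⟩ := hp
    obtain ⟨hZr, hZc⟩ := cyclic_part_of_plane_type hG hq hcard hS
    have hS' := mem_Pc.1 hS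
    have hSG := (mem_Rq.1 hS'.1).1
    have hB := mem_basesOf.1 hB₀
    have hK := coloopsOf_subset_of_basis_subset hG hS'.1 hB₀ hBS
    -- `T = B₀ ∖ K` is a `3`-subset of `B₀` inside `Z`
    have hTc : (B₀ \ coloopsOf M S).card = 3 := by
      rw [Finset.card_sdiff_of_subset hK, hB.2.2]
      unfold mTr at hS'
      omega
    have hTZ : B₀ \ coloopsOf M S ⊆ S \ coloopsOf M S := Finset.sdiff_subset_sdiff hBS (Finset.Subset.refl _)
    rw [Finset.mem_coe, Finset.mem_sigma, Finset.mem_filter, Finset.mem_powersetCard]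
    refine ⟨hB₀, ⟨Finset.sdiff_subset, hTc⟩, ?_⟩
    -- `K_T = Z ∖ T`: `Z ∖ T ⊆ K_T` (`Z ⊆ cl T`, rank `3` both) and `|K_T| ≤ 3 = |Z ∖ T|`
    have hTr : M.eRk ((B₀ \ coloopsOf M S : Finset α) : Set α) = ((3 : ℕ) : ℕ∞) := by
      have hI := indep_of_mem_basesOf hB₀
      rw [(hI.subset (Finset.coe_subset.2 Finset.sdiff_subset)).eRk_eq_encard, Set.encard_coe_eq_coe_finsetCard, hTc]
    have hcl : M.closure ((B₀ \ coloopsOf M S : Finset α) : Set α) = M.closure ((S \ coloopsOf M S : Finset α) : Set α) :=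
      (M.isRkFinite_of_finite (Finset.finite_toSet _)).closure_eq_closure_of_subset_of_eRk_ge_eRk
        (Finset.coe_subset.2 hTZ) (by rw [hZr, hTr])
    have hsub : (S \ coloopsOf M S) \ (B₀ \ coloopsOf M S) ⊆ KT M G B₀ (B₀ \ coloopsOf M S) := by
      intro x hx
      rw [Finset.mem_sdiff, Finset.mem_sdiff, Finset.mem_sdiff] at hx
      obtain ⟨⟨hxS, hxK⟩, hx2⟩ := hx
      have hxB : x ∉ B₀ := fun h => hx2 ⟨h, hxK⟩
      rw [mem_KT, Finset.mem_sdiff]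
      refine ⟨⟨hSG hxS, hxB⟩, ?_⟩
      rw [hcl]
      have hxE : x ∈ M.E := by
        rw [← coe_gr M]
        exact Finset.mem_coe.2 (hG (hSG hxS))
      exact M.mem_closure_of_mem' (Finset.mem_coe.2 (Finset.mem_sdiff.2 ⟨hxS, hxK⟩)) hxE
    have h3 := card_KT_le_three hplane hG hB₀ (Finset.mem_powersetCard.2 ⟨Finset.sdiff_subset, hTc⟩)
    have hZT : ((S \ coloopsOf M S) \ (B₀ \ coloopsOf M S)).card = 3 := by
      rw [Finset.card_sdiff_of_subset hTZ, hZc, hTc]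
      omega
    have := Finset.card_le_card hsub
    show (KT M G B₀ (B₀ \ coloopsOf M S)).card = 3
    omega
  · rintro ⟨S, B₀⟩ hp ⟨S', B₀'⟩ hp' heq
    rw [Finset.mem_coe, Finset.mem_sigma, Finset.mem_filter] at hp hp'
    simp only at hp hp'
    simp only [Sigma.mk.injEq] at heq
    obtain ⟨hBeq, hTeq⟩ := heq
    subst hBeq
    have hTeq' : B₀ \ coloopsOf M S = B₀ \ coloopsOf M S' := eq_of_heq hTeq
    -- `S = B₀ ∪ K_T`: recover `S` from `(B₀, T)`
    have key : ∀ (S₀ : Finset α), S₀ ∈ Pc M G q (d - 3) (q - 3) → B₀ ⊆ S₀ →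
        S₀ = B₀ ∪ KT M G B₀ (B₀ \ coloopsOf M S₀) := by
      intro S₀ hS₀ hBS₀
      obtain ⟨hZr, hZc⟩ := cyclic_part_of_plane_type hG hq hcard hS₀
      have hS₀' := mem_Pc.1 hS₀
      have hS₀G := (mem_Rq.1 hS₀'.1).1
      have hB := mem_basesOf.1 hp.2.1
      have hK := coloopsOf_subset_of_basis_subset hG hS₀'.1 hp.2.1 hBS₀
      have hTc : (B₀ \ coloopsOf M S₀).card = 3 := by
        rw [Finset.card_sdiff_of_subset hK, hB.2.2]
        unfold mTr at hS₀'
        omega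
      have hTZ : B₀ \ coloopsOf M S₀ ⊆ S₀ \ coloopsOf M S₀ := Finset.sdiff_subset_sdiff hBS₀ (Finset.Subset.refl _)
      have hTr : M.eRk ((B₀ \ coloopsOf M S₀ : Finset α) : Set α) = ((3 : ℕ) : ℕ∞) := by
        have hI := indep_of_mem_basesOf hp.2.1
        rw [(hI.subset (Finset.coe_subset.2 Finset.sdiff_subset)).eRk_eq_encard, Set.encard_coe_eq_coe_finsetCard, hTc]
      have hcl : M.closure ((B₀ \ coloopsOf M S₀ : Finset α) : Set α) =
          M.closure ((S₀ \ coloopsOf M S₀ : Finset α) : Set α) :=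
        (M.isRkFinite_of_finite (Finset.finite_toSet _)).closure_eq_closure_of_subset_of_eRk_ge_eRk
          (Finset.coe_subset.2 hTZ) (by rw [hZr, hTr])
      have hsub : (S₀ \ coloopsOf M S₀) \ (B₀ \ coloopsOf M S₀) ⊆ KT M G B₀ (B₀ \ coloopsOf M S₀) := by
        intro x hx
        rw [Finset.mem_sdiff, Finset.mem_sdiff, Finset.mem_sdiff] at hx
        obtain ⟨⟨hxS, hxK⟩, hx2⟩ := hx
        have hxB : x ∉ B₀ := fun h => hx2 ⟨h, hxK⟩
        rw [mem_KT, Finset.mem_sdiff]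
        refine ⟨⟨hS₀G hxS, hxB⟩, ?_⟩
        rw [hcl]
        have hxE : x ∈ M.E := by
          rw [← coe_gr M]
          exact Finset.mem_coe.2 (hG (hS₀G hxS))
        exact M.mem_closure_of_mem' (Finset.mem_coe.2 (Finset.mem_sdiff.2 ⟨hxS, hxK⟩)) hxE
      have h3 := card_KT_le_three hplane hG hp.2.1 (Finset.mem_powersetCard.2 ⟨Finset.sdiff_subset, hTc⟩)
      have hZT : ((S₀ \ coloopsOf M S₀) \ (B₀ \ coloopsOf M S₀)).card = 3 := by
        rw [Finset.card_sdiff_of_subset hTZ, hZc, hTc]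
        omega
      have hKeq : KT M G B₀ (B₀ \ coloopsOf M S₀) = (S₀ \ coloopsOf M S₀) \ (B₀ \ coloopsOf M S₀) :=
        (Finset.eq_of_subset_of_card_le hsub (by omega)).symm
      rw [hKeq]
      ext x
      rw [Finset.mem_union, Finset.mem_sdiff, Finset.mem_sdiff, Finset.mem_sdiff]
      constructor
      · intro hx
        by_cases hxB : x ∈ B₀
        · exact Or.inl hxB
        · by_cases hxK : x ∈ coloopsOf M S₀
          · exact absurd (hK hxK) hxB
          · exact Or.inr ⟨⟨hx, hxK⟩, fun h => hxB h.1⟩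
      · rintro (hx | ⟨⟨hx, _⟩, _⟩)
        · exact hBS₀ hx
        · exact hx
    rw [key S hp.1 hp.2.2, key S' hp'.1 hp'.2.2, hTeq']

/-- **THE ROW (R2)**: `48·#Pc (d−3) (q−3) ≤ 3(q−2)·#Pc (d−1) (q−2) + 4·#Pc (d−1) (q−3)` (lines `≤ 3`, planes `≤ 6`,
`q ≥ 3`, `d ≥ 3`). -/
theorem card_Pc_sub_three_plane_le (hs : Simple M) (hline : ∀ L ∈ flatsQ M 2, L.card ≤ 3)
    (hplane : ∀ P ∈ flatsQ M 3, P.card ≤ 6) {G : Finset α} {q d : ℕ} (hG : G ⊆ gr M)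
    (hrG : M.eRk (G : Set α) = (q : ℕ∞)) (hq : 3 ≤ q) (hcard : G.card = q + d) (hd : 3 ≤ d) :
    48 * (Pc M G q (d - 3) (q - 3)).card ≤
      3 * (q - 2) * (Pc M G q (d - 1) (q - 2)).card + 4 * (Pc M G q (d - 1) (q - 3)).card := by
  have h1 : 16 * (Pc M G q (d - 3) (q - 3)).card ≤ ∑ S ∈ Pc M G q (d - 3) (q - 3), nb M G S q := by
    rw [Finset.card_eq_sum_ones, Finset.mul_sum]
    exact Finset.sum_le_sum (fun S hS => by rw [mul_one]; exact sixteen_le_nb hs hline hG hq hcard hS hd)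
  have h2 := sum_nb_plane_le hplane hG hq hcard hd
  have h3 : ∀ B₀ ∈ basesOf M G q, 3 * ((B₀.powersetCard 3).filter (fun T => (KT M G B₀ T).card = 3)).card ≤
      (q - 2) * kc M G B₀ 3 + kc M G B₀ 4 := by
    intro B₀ hB₀
    refine le_trans ?_ (sum_card_KT_le hs hG hrG hq hB₀)
    calc 3 * ((B₀.powersetCard 3).filter (fun T => (KT M G B₀ T).card = 3)).card
        = ∑ T ∈ (B₀.powersetCard 3).filter (fun T => (KT M G B₀ T).card = 3), (KT M G B₀ T).card := by
          rw [Finset.card_eq_sum_ones, Finset.mul_sum]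
          apply Finset.sum_congr rfl
          intro T hT
          rw [mul_one, ((Finset.mem_filter.1 hT).2)]
      _ ≤ ∑ T ∈ B₀.powersetCard 3, (KT M G B₀ T).card :=
          Finset.sum_le_sum_of_subset_of_nonneg (Finset.filter_subset _ _) (fun _ _ _ => Nat.zero_le _)
  have h4 : 3 * ∑ B₀ ∈ basesOf M G q, ((B₀.powersetCard 3).filter (fun T => (KT M G B₀ T).card = 3)).card ≤
      (q - 2) * ∑ B₀ ∈ basesOf M G q, kc M G B₀ 3 + ∑ B₀ ∈ basesOf M G q, kc M G B₀ 4 := by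
    rw [Finset.mul_sum, Finset.mul_sum, ← Finset.sum_add_distrib]
    exact Finset.sum_le_sum h3
  rw [sum_kc_eq hG hrG hcard (by omega) (by omega), sum_kc_eq hG hrG hcard (by omega) (by omega)] at h4
  have h5 : q + 1 - 3 = q - 2 := by omega
  have h6 : q + 1 - 4 = q - 3 := by omega
  rw [h5, h6] at h4
  have h7 : (q - 2) * (3 * (Pc M G q (d - 1) (q - 2)).card) = 3 * (q - 2) * (Pc M G q (d - 1) (q - 2)).card := by
    ring
  rw [h7] at h4
  omega

end PercRepro.Night4
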